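/-
Copyright (c) 2026 the pub-hodgecm-mathlib formalisation cell (harness21).  Prover seat hodgecm-mathlib-K2Liu-p12 (g3): Track B «K2-LIT»,
#184♮ = hLiu418 = stmt-HodgeConjecture-24832; #42S payer road, organ S1, LAST FILE of K2Liu-p01 (g8), brick (B5) «the index `q^{4m}`» — one-dimensional inputs.
-/
import Summits.HodgeConjecture.HodgeConjecture.Theorems.K2LiuSkewBallVolumeGrowth       -- ★ (G1) `relIndex_mul_measure`, `relIndex_ne_zero_of_isOpen_of_isCompact`
import Literature.NumberTheory.Automorphic.LocalFieldHaarBalls                            -- ★ `measure_primePowBall_eq_mul_succ` (`μ(𝔭^m) = q·μ(𝔭^{m+1})`)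
import HarnessLib

/-!
# Crux `HLiu418`, organ S1, brick (B5) inputs: `[𝔭^m : 𝔭^{m+k}] = q^k` IN A NON-ARCHIMEDEAN LOCAL FIELD, AS A RELATIVE INDEX OF ADDITIVE SUBGROUPS

Cell `hodgecm-mathlib`, crux item hLiu418 = `stmt-HodgeConjecture-24832`, route of record `HCCMUnconditional`; squad K2 ∕ K2Liu, road `K2_Liu`, #42S payer
road, organ S1 (the `hcard : Fintype.card (S₁ ⧸ S₀.addSubgroupOf S₁) = q ^ (4 * m)` letter of ★ (J) `K2LiuInertTransportedProfileSum`).  THEOREMS ONLY (no `def`, no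
`instance`, no `notation`, no named-fact hypothesis, no `sorry`); lane `--supports stmt-HodgeConjecture-24832` (count-neutral helper; closes no socket by itself).

THE MATHEMATICS.  For a non-archimedean local field `K` with residue field of `q` elements and its balls `𝔭^m = primePowBall K m` (★ `TateLocalZetaShells`:
compact, open, additive), the relative index of `𝔭^{m+1}` in `𝔭^m` is `q`: ★ (G1) `[K:H]·μ(H) = μ(K)` (`K2LiuSkewBallVolumeGrowth.relIndex_mul_measure`) against
★ `μ(𝔭^m) = q·μ(𝔭^{m+1})` (`LocalFieldHaar.measure_primePowBall_eq_mul_succ`), `0 < μ(𝔭^{m+1}) < ∞`.  Iterating, `[𝔭^m : 𝔭^{m+k}] = q^k`.  Stated for additive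
subgroups `B` GIVEN BY THEIR CARRIERS (`(B : Set K) = primePowBall K m`), the currency of ★ F3e∕(B) (`exists_addSubgroup_…`), so that the consumer's `Fintype.card (B ⧸ …)`
is `AddSubgroup.relIndex` by `AddSubgroup.index`'s definition.
* `exists_addSubgroup_primePowBall` · `le_of_carrier_eq_primePowBall` · `relIndex_eq_residueFieldCard` (one step) · `relIndex_eq_residueFieldCard_pow` (`k` steps).
HONEST LABEL.  Count-neutral helper; it retires nothing by itself: `HC_CM` is proved only modulo the 7 printed citations (2 remaining named inputs:
hLiu418 = `stmt-HodgeConjecture-24832`, h413 = `stmt-HodgeConjecture-24833`) until rung 0 closes.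

## References
* [WeilBNT1967] A. Weil, *Basic Number Theory* (1967): Ch. I §2–§4 (`μ(𝔭^m)`, the module of a local field).
* [BushnellHenniart2006] C. Bushnell, G. Henniart, *The Local Langlands Conjecture for GL(2)* (2006): §1.1 (lattice indices).
-/

set_option autoImplicit false
-- the mandated namespace repeats the single-problem summit's segment (`HodgeConjecture.HodgeConjecture`)
set_option linter.dupNamespace false

noncomputable section

open scoped NNReal ENNReal Topology
open MeasureTheory Set
open Literature.NumberTheory.Automorphic
open Literature.NumberTheory.GaloisRepresentations.IsNonarchimedeanLocalField
open Literature.NumberTheory.Automorphic.LocalFieldHaar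
open Summit.HodgeConjecture.HodgeConjecture.Cruxes.HLiu418.K2LiuSkewBallVolumeGrowth

namespace Summit.HodgeConjecture.HodgeConjecture.Cruxes.HLiu418.K2LiuLocalBallIndices

variable {K : Type*} [Field K] [ValuativeRel K] [TopologicalSpace K] [IsNonarchimedeanLocalField K]

/-- **`𝔭^m` is (the carrier of) an additive subgroup** (★ `zero_mem_∕add_mem_∕neg_mem_primePowBall`). [cite: BushnellHenniart2006, §1.1] -/
theorem exists_addSubgroup_primePowBall (m : ℤ) : ∃ B : AddSubgroup K, (B : Set K) = primePowBall K m :=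
  ⟨{ carrier := primePowBall K m, add_mem' := fun ha hb => add_mem_primePowBall ha hb, zero_mem' := zero_mem_primePowBall m,
     neg_mem' := fun ha => neg_mem_primePowBall ha }, rfl⟩

/-- `𝔭^{m'} ≤ 𝔭^m` for `m ≤ m'` (★ `primePowBall_antitone`), in subgroup currency. [cite: BushnellHenniart2006, §1.1] -/
theorem le_of_carrier_eq_primePowBall {m m' : ℤ} (h : m ≤ m') {B B' : AddSubgroup K} (hB : (B : Set K) = primePowBall K m)
    (hB' : (B' : Set K) = primePowBall K m') : B' ≤ B := by
  intro x hx
  have hx' : x ∈ (B' : Set K) := hx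
  rw [hB'] at hx'
  have hxB : x ∈ (B : Set K) := by rw [hB]; exact primePowBall_antitone h hx'
  exact hxB

/-- **`[𝔭^m : 𝔭^{m+1}] = q`** as a relative index of additive subgroups (★ (G1) `relIndex_mul_measure` against ★ `measure_primePowBall_eq_mul_succ`, cancelling the finite
non-zero Haar measure of the compact open `𝔭^{m+1}`). [cite: WeilBNT1967, Ch. I §4] [cite: BushnellHenniart2006, §1.1] -/
theorem relIndex_eq_residueFieldCard {m : ℤ} {B B' : AddSubgroup K} (hB : (B : Set K) = primePowBall K m) (hB' : (B' : Set K) = primePowBall K (m + 1)) :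
    B'.relIndex B = residueFieldCard K := by
  borelize K
  set μ : Measure K := Measure.addHaar
  have hle : B' ≤ B := le_of_carrier_eq_primePowBall (show m ≤ m + 1 by omega) hB hB'
  have hB'o : IsOpen (B' : Set K) := by rw [hB']; exact isOpen_primePowBall (m + 1)
  have hBo : IsOpen (B : Set K) := by rw [hB]; exact isOpen_primePowBall m
  have hB'c : IsCompact (B' : Set K) := by rw [hB']; exact isCompact_primePowBall (m + 1)
  have hBc : IsCompact (B : Set K) := by rw [hB]; exact isCompact_primePowBall m
  have hfin : B'.relIndex B ≠ 0 := relIndex_ne_zero_of_isOpen_of_isCompact hB'o hBc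
  have h1 := relIndex_mul_measure μ hle hB'o.measurableSet hBo.measurableSet hfin
  have h2 : μ (B : Set K) = (residueFieldCard K : ℝ≥0∞) * μ (B' : Set K) := by
    rw [hB, hB']; exact measure_primePowBall_eq_mul_succ μ m
  have hne0 : μ (B' : Set K) ≠ 0 := hB'o.measure_ne_zero μ ⟨0, B'.zero_mem⟩
  have hneT : μ (B' : Set K) ≠ ⊤ := hB'c.measure_lt_top.ne
  have h3 : ((B'.relIndex B : ℕ) : ℝ≥0∞) = ((residueFieldCard K : ℕ) : ℝ≥0∞) := (ENNReal.mul_left_inj hne0 hneT).1 (h1.trans h2)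
  exact_mod_cast h3

/-- **`[𝔭^m : 𝔭^{m+k}] = q^k`** (iterate the one-step index along `𝔭^{m+k} ≤ … ≤ 𝔭^{m+1} ≤ 𝔭^m`, Mathlib `AddSubgroup.relIndex_mul_relIndex`).
[cite: WeilBNT1967, Ch. I §4] [cite: BushnellHenniart2006, §1.1] -/
theorem relIndex_eq_residueFieldCard_pow {m : ℤ} (k : ℕ) {B B' : AddSubgroup K} (hB : (B : Set K) = primePowBall K m)
    (hB' : (B' : Set K) = primePowBall K (m + k)) : B'.relIndex B = residueFieldCard K ^ k := by
  induction k generalizing B' with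
  | zero =>
    have hBB' : B' = B := SetLike.coe_injective (by rw [hB', hB, Nat.cast_zero, add_zero])
    rw [hBB', AddSubgroup.relIndex_self, pow_zero]
  | succ k ih =>
    obtain ⟨B₁, hB₁⟩ := exists_addSubgroup_primePowBall (K := K) (m + k)
    have h1 : B₁.relIndex B = residueFieldCard K ^ k := ih hB₁
    have h2 : B'.relIndex B₁ = residueFieldCard K :=
      relIndex_eq_residueFieldCard hB₁ (by rw [hB', Nat.cast_succ, add_assoc])
    have hle₁ : B' ≤ B₁ := le_of_carrier_eq_primePowBall (by push_cast; omega) hB₁ hB'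
    have hle₂ : B₁ ≤ B := le_of_carrier_eq_primePowBall (by omega) hB hB₁
    rw [← AddSubgroup.relIndex_mul_relIndex B' B₁ B hle₁ hle₂, h2, h1, pow_succ, mul_comm]

end Summit.HodgeConjecture.HodgeConjecture.Cruxes.HLiu418.K2LiuLocalBallIndices

end
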